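import Summits.ResolutionOfSingularities.ResolutionOfSingularities.Theorems.EquisingularLiftEquisingularLiftNatP1VBNowhereVanishing
import Literature.AlgebraicGeometry.Modules.SheafHomFrames
import Literature.AlgebraicGeometry.Modules.PullbackAffineChart
import Literature.AlgebraicGeometry.Modules.CokernelSupport
import Literature.AlgebraicGeometry.Modules.FrameTransition
import HarnessLib

/-!
# [OURS · L1 W4.5(b) · T-P1VB part 12] Sub-bundle transfer for morphisms: `g^*σ` nowhere degenerate ⇒ `σ` nowhere
# degenerate ⇒ `σ` locally split; and locally split ⇒ nowhere degenerate

Cell res-hironaka, LADDER-RESOLUTION rung L (D-0089), slot W4.5(b), crux `Theses.EquisingularLift.EquisingularLiftNat`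
(stmt-ResolutionOfSingularities-20038) / child `EquisingularLiftNatThree` (stmt-ResolutionOfSingularities-20148); object **T-P1VB**
(res-L1-w45b-lead-2 BOOK 2026-08-27T09:28:20Z; rung v8 DIR₀), `--supports stmt-ResolutionOfSingularities-20148 --as helper`.
NOT a statement of any manuscript; OURS. AI-written; AI review is weaker than expert review.

WHY. Part 11 lifts a morphism `ψ₀ : g^*K̃ → g^*𝒞` to `σ : K̃ → 𝒞` with `g^*σ = ψ₀`; DIR₀ wants `σ` to be a SUB-LINE-BUNDLE
(locally split monomorphism) because `ψ₀` (the embedding `L₀ ↪ 𝒞_k`) is one. A morphism `σ : K → F` is a global section of the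
vector bundle `𝓗om(K, F)`, "nowhere degenerate" = nowhere vanishing there (part 4 `IsNowhereVanishing`), and in the frames
`homFrame κ w` (tree `Modules/SheafHomFrames`) its coordinates are the coordinates of `σ(b_j)` in `w` (`coord_homFrame`). So part 4's
transfer («a lift of a nowhere-vanishing section over a universally closed `X` on a local base is nowhere vanishing») applies, once
the coordinates of `η(σ) ∈ Γ(g^*𝓗om(K, F))` and of `g^*σ ∈ Γ(𝓗om(g^*K, g^*F))` in the pulled-back frames are identified — both are
`g♯(coord_w(σ(b_j))_i)` (`coord_pullbackFrame_unitSection`, `pullback_map_app_unitSection`); no comparison of the two modules is needed.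

WHAT.
* **`isNowhereVanishing_hom_of_pullback`** — `f : X → Spec A` universally closed, `A` local, `g` the base change of a surjection
  `φ : A → B ≠ 0`, `K, F` finite locally free, `σ : K → F`: if `g^*σ` is nowhere vanishing as a section of `𝓗om(g^*K, g^*F)` then
  `σ` is nowhere vanishing as a section of `𝓗om(K, F)`;
* **`exists_retraction_of_isNowhereVanishing_hom`** — for `K` a line bundle: `σ` nowhere vanishing in `𝓗om(K, F)` ⇒ `σ` is locally
  split (`σ|_W ≫ r = 𝟙` near every point), i.e. `K ↪ F` is a sub-line-bundle;
* **`isNowhereVanishing_hom_of_retraction`** — conversely (any scheme): a locally split `τ : K' → F'` (`K'` a line bundle, `F'` finite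
  locally free) is nowhere vanishing in `𝓗om(K', F')` — the form in which DIR₀ holds the hypothesis for `L₀ ↪ 𝒞_k` downstairs.

References (index only): Hartshorne II Ex. 5.1 (b), II.5 (p. 110); EGA IV 11.3 (flatness/sub-bundles along fibres), here elementary.
-/

noncomputable section

-- `TopCat.Presheaf`/`Scheme.Modules` are not reducible (as in Mathlib's `AlgebraicGeometry/Modules`).
set_option backward.isDefEq.respectTransparency false

open CategoryTheory AlgebraicGeometry Limits TopologicalSpace Opposite
open Literature.AlgebraicGeometry.Modules Literature.AlgebraicGeometry.Morphisms Literature.AlgebraicGeometry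

universe u

set_option linter.dupNamespace false -- mandated namespace `Summit.<Summit>.<Problem>` of this single-conjunct summit

namespace Summit.ResolutionOfSingularities.ResolutionOfSingularities.Cruxes.EquisingularLiftNat.P1VB

/-! ### Coordinates of a morphism in `homFrame`, upstairs and downstairs -/

section Coordinates

variable {X Y : Scheme.{u}} (g : Y ⟶ X) {K F : X.Modules} (σ : K ⟶ F) {W : X.Opens} {J I : Type u} [Fintype J] [Fintype I]
  (κ : SheafOfModules.free J ≅ K.over W) (w : SheafOfModules.free I ≅ F.over W)

/-- The global section `σ̂ ∈ Γ(X, 𝓗om(K, F))` of a morphism `σ : K → F`. [folklore] -/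
abbrev homSection : Γ(sheafHom K F, ⊤) :=
  ((SheafOfModules.overFunctor _ ⊤).map σ : K.over ⊤ ⟶ F.over ⊤)

/-- Values of the restriction `σ̂|_W`: `s ↦ σ(s)`. [folklore] -/
theorem appLE_map_homSection {V : X.Opens} (k : V ⟶ W) (s : Γ(K, V)) :
    appLE ((sheafHom K F).presheaf.map (homOfLE (le_top : W ≤ ⊤)).op (homSection σ) : K.over W ⟶ F.over W) k s =
      σ.app V s := rfl

/-- **Coordinates of `σ̂|_W` in `homFrame κ w`**: the `(j,i)` coordinate is the `i`-th coordinate of `σ(b_j)` in `w`. [folklore] -/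
theorem coord_homFrame_homSection (ji : J × I) :
    coord (homFrame κ w) (𝟙 W) ((sheafHom K F).presheaf.map (homOfLE (le_top : W ≤ ⊤)).op (homSection σ)) ji =
      coord w (𝟙 W) (σ.app W (basisSection κ ji.1)) ji.2 := by
  rw [coord_homFrame, presheaf_map_id]
  rfl

/-- **Coordinates of `η(σ̂)|_{g⁻¹W}` in the pulled-back frame of `homFrame κ w`**: `g♯` of those of `σ̂`. [folklore] -/
theorem coord_pullbackFrame_unitSection_homSection (ji : J × I) :
    coord (E := (Scheme.Modules.pullback g).obj (sheafHom K F)) (pullbackFrame g (homFrame κ w)) (𝟙 (g ⁻¹ᵁ W))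
        (((Scheme.Modules.pullback g).obj (sheafHom K F)).presheaf.map (homOfLE (le_top : g ⁻¹ᵁ W ≤ ⊤)).op
          (unitSection g (sheafHom K F) ⊤ (homSection σ))) ji =
      g.app W (coord w (𝟙 W) (σ.app W (basisSection κ ji.1)) ji.2) := by
  have hres : ((Scheme.Modules.pullback g).obj (sheafHom K F)).presheaf.map (homOfLE (le_top : g ⁻¹ᵁ W ≤ ⊤)).op
      (unitSection g (sheafHom K F) ⊤ (homSection σ)) =
      unitSection g (sheafHom K F) W ((sheafHom K F).presheaf.map (homOfLE (le_top : W ≤ ⊤)).op (homSection σ)) := by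
    rw [unitSection_map]
    rfl
  rw [hres, coord_pullbackFrame_unitSection, coord_homFrame_homSection]

/-- **Coordinates of `(g^*σ)^|_{g⁻¹W}` in `homFrame (g^*κ) (g^*w)`**: the same elements `g♯(coord_w(σ(b_j))_i)`
(`(g^*σ)(η b_j) = η(σ b_j)` and the coordinates of `η(s)` in `g^*w` are `g♯` of those of `s`). [folklore] -/
theorem coord_homFrame_homSection_pullback (ji : J × I) :
    coord (homFrame (pullbackFrame g κ) (pullbackFrame g w)) (𝟙 (g ⁻¹ᵁ W))
        ((sheafHom ((Scheme.Modules.pullback g).obj K) ((Scheme.Modules.pullback g).obj F)).presheaf.map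
          (homOfLE (le_top : g ⁻¹ᵁ W ≤ ⊤)).op (homSection ((Scheme.Modules.pullback g).map σ))) ji =
      g.app W (coord w (𝟙 W) (σ.app W (basisSection κ ji.1)) ji.2) := by
  rw [coord_homFrame_homSection, basisSection_pullbackFrame, pullback_map_app_unitSection, coord_pullbackFrame_unitSection]

end Coordinates

/-! ### The transfer along a universally closed `X → Spec A`, `A` local -/

section Transfer

variable {A B : Type u} [CommRing A] [IsLocalRing A] [CommRing B] [Nontrivial B] (φ : A →+* B)
  {X Y : Scheme.{u}} (f : X ⟶ Spec (.of A)) {g : Y ⟶ X} {t : Y ⟶ Spec (.of B)}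

/-- **T-P1VB part 12 — `g^*σ` nowhere degenerate ⇒ `σ` nowhere degenerate.** `f : X → Spec A` universally closed, `A` local,
`g` the base change of a surjection `φ : A → B ≠ 0`, `K, F` finite locally free, `σ : K → F`. If `g^*σ` is nowhere vanishing as a
global section of `𝓗om(g^*K, g^*F)` then `σ` is nowhere vanishing as a global section of `𝓗om(K, F)` (part 4 for the vector bundle
`𝓗om(K, F)`, after identifying coordinates in the pulled-back `homFrame`s). [folklore] -/
theorem isNowhereVanishing_hom_of_pullback [UniversallyClosed f] (hφ : Function.Surjective φ)
    (H : IsPullback g t f (Spec.map (CommRingCat.ofHom φ))) {K F : X.Modules}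
    (hK : Motives.IsFiniteLocallyFree K) (hF : Motives.IsFiniteLocallyFree F) (σ : K ⟶ F)
    (hσ : IsNowhereVanishing (sheafHom ((Scheme.Modules.pullback g).obj K) ((Scheme.Modules.pullback g).obj F))
      (homSection ((Scheme.Modules.pullback g).map σ))) :
    IsNowhereVanishing (sheafHom K F) (homSection σ) := by
  refine IsNowhereVanishing.of_unitSection φ f hφ H (isFiniteLocallyFree_sheafHom' hK hF) _ fun y => ?_
  -- frames of `K` and `F` on a common open `W ∋ g y`
  obtain ⟨W₁, hy₁, J, hJ, ⟨κ₁⟩⟩ := hK (g.base y)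
  obtain ⟨W₂, hy₂, I, hI, ⟨w₂⟩⟩ := hF (g.base y)
  haveI := Fintype.ofFinite J
  haveI := Fintype.ofFinite I
  let κ : SheafOfModules.free J ≅ K.over (W₁ ⊓ W₂) :=
    Motives.SheafOfModules.restrictTrivialisation (R := X.ringCatSheaf) (homOfLE inf_le_left) κ₁
  let w : SheafOfModules.free I ≅ F.over (W₁ ⊓ W₂) :=
    Motives.SheafOfModules.restrictTrivialisation (R := X.ringCatSheaf) (homOfLE inf_le_right) w₂
  have hyW : y ∈ g ⁻¹ᵁ (W₁ ⊓ W₂) := show g.base y ∈ W₁ ⊓ W₂ from ⟨hy₁, hy₂⟩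
  -- downstairs some coordinate of `g^*σ` in `homFrame (g^*κ) (g^*w)` is invertible at `y`
  obtain ⟨ji, hji⟩ := hσ.exists_mem_basicOpen y hyW (homFrame (pullbackFrame g κ) (pullbackFrame g w))
  rw [coord_homFrame_homSection_pullback] at hji
  refine ⟨g ⁻¹ᵁ (W₁ ⊓ W₂), hyW, J × I, inferInstance, pullbackFrame g (homFrame κ w), ji, ?_⟩
  rw [coord_pullbackFrame_unitSection_homSection]
  exact hji

end Transfer

/-! ### Nowhere degenerate ⇔ locally split, for `K` a line bundle -/

section Split

variable {X : Scheme.{0}} {K F : X.Modules}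

/-- **Nowhere degenerate ⇒ locally split**: for `K` a line bundle (free of rank one near every point), `F` finite locally free
and `σ : K → F` nowhere vanishing in `𝓗om(K, F)`, every point has a neighbourhood `W` and `r : F|_W → K|_W` with
`σ|_W ≫ r = 𝟙` (on `W = D(c)`, `c` an invertible coordinate of `σ(b)`: `r = c⁻¹ λ_i(–) · b`). [folklore] -/
theorem exists_retraction_of_isNowhereVanishing_hom
    (hK : ∀ x : X, ∃ (W : X.Opens) (_ : x ∈ W), Nonempty (SheafOfModules.free (Fin 1) ≅ K.over W))
    (hF : Motives.IsFiniteLocallyFree F) (σ : K ⟶ F) (hσ : IsNowhereVanishing (sheafHom K F) (homSection σ)) (x : X) :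
    ∃ (W : X.Opens) (_ : x ∈ W) (r : F.over W ⟶ K.over W), (SheafOfModules.overFunctor _ W).map σ ≫ r = 𝟙 _ := by
  obtain ⟨W₁, hx₁, ⟨κ₁⟩⟩ := hK x
  obtain ⟨W₂, hx₂, I, hI, ⟨w₂⟩⟩ := hF x
  haveI := Fintype.ofFinite I
  obtain ⟨W, hxW, ⟨κ⟩, ⟨w⟩⟩ : ∃ (W : X.Opens) (_ : x ∈ W), Nonempty (SheafOfModules.free (Fin 1) ≅ K.over W) ∧
      Nonempty (SheafOfModules.free I ≅ F.over W) :=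
    ⟨W₁ ⊓ W₂, ⟨hx₁, hx₂⟩, ⟨Motives.SheafOfModules.restrictTrivialisation (R := X.ringCatSheaf) (homOfLE inf_le_left) κ₁⟩,
      ⟨Motives.SheafOfModules.restrictTrivialisation (R := X.ringCatSheaf) (homOfLE inf_le_right) w₂⟩⟩
  obtain ⟨⟨j, i⟩, hji⟩ := hσ.exists_mem_basicOpen x hxW (homFrame κ w)
  obtain rfl : j = 0 := Subsingleton.elim _ _
  rw [coord_homFrame_homSection] at hji
  -- `W' = D(c)`, `c = coord_w(σ(b))_i`, on which `c` is a unit `u`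
  set c : Γ(X, W) := coord w (𝟙 W) (σ.app W (basisSection κ 0)) i with hc
  have hle : X.basicOpen c ≤ W := X.basicOpen_le c
  obtain ⟨u, hu⟩ := isUnit_map_of_le_basicOpen c (le_refl (X.basicOpen c))
  refine ⟨X.basicOpen c, hji,
    ((↑u⁻¹ : Γ(X, X.basicOpen c)) • restrictHom (homOfLE hle) (dualBasis w i)) ≫
      smulSection (K.presheaf.map (homOfLE hle).op (basisSection κ 0)), ?_⟩
  -- check on the generator `b|_{D(c)}`
  refine hom_ext_of_basisSection (Motives.SheafOfModules.restrictTrivialisation (R := X.ringCatSheaf) (homOfLE hle) κ)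
    fun j => ?_
  obtain rfl : j = 0 := Subsingleton.elim _ _
  rw [basisSection_restrictTrivialisation, appLE_id, appLE_comp, appLE_over_map, appLE_comp, appLE_smulSection,
    presheaf_map_id, appLE_smul, structurePresheaf_map_id, appLE_restrictHom, Category.id_comp, ← coord_def,
    Motives.Scheme.Modules.Hom.app_map_apply]
  have hcm := coord_map w (𝟙 W) (homOfLE hle) (σ.app W (basisSection κ 0)) i
  rw [Category.comp_id] at hcm
  rw [hcm, smul_eq_mul, ← hc, ← hu, Units.inv_mul, one_smul]

/-- The germ of a finite sum of products. [folklore] -/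
private theorem germ_sum_mul {U : X.Opens} {x : X} (hx : x ∈ U) {ι : Type*} (t : Finset ι) (c d : ι → Γ(X, U)) :
    X.presheaf.germ U x hx (∑ a ∈ t, c a * d a) = ∑ a ∈ t, X.presheaf.germ U x hx (c a) * X.presheaf.germ U x hx (d a) := by
  rw [map_sum]
  exact Finset.sum_congr rfl fun a _ => map_mul _ _ _

/-- **Locally split ⇒ nowhere degenerate** (any scheme): `K'` a line bundle, `F'` finite locally free, `τ : K' → F'` with a
retraction near every point; then `τ` is nowhere vanishing in `𝓗om(K', F')` (if all coordinates `c_i` of `τ(b)` vanished at `y`,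
so would `1 = λ(b) = λ(r(τ b)) = ∑ c_i λ(r(w_i))` in `κ(y)`). [folklore] -/
theorem isNowhereVanishing_hom_of_retraction
    (hK : ∀ x : X, ∃ (W : X.Opens) (_ : x ∈ W), Nonempty (SheafOfModules.free (Fin 1) ≅ K.over W))
    (hF : Motives.IsFiniteLocallyFree F) (τ : K ⟶ F)
    (hτ : ∀ x : X, ∃ (W : X.Opens) (_ : x ∈ W) (r : F.over W ⟶ K.over W), (SheafOfModules.overFunctor _ W).map τ ≫ r = 𝟙 _) :
    IsNowhereVanishing (sheafHom K F) (homSection τ) := by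
  classical
  intro x
  obtain ⟨W₀, hx₀, r₀, hr₀⟩ := hτ x
  obtain ⟨W₁, hx₁, ⟨κ₁⟩⟩ := hK x
  obtain ⟨W₂, hx₂, I, hI, ⟨w₂⟩⟩ := hF x
  haveI := Fintype.ofFinite I
  let W := W₀ ⊓ (W₁ ⊓ W₂)
  have h0 : W ≤ W₀ := inf_le_left
  let κ : SheafOfModules.free (Fin 1) ≅ K.over W :=
    Motives.SheafOfModules.restrictTrivialisation (R := X.ringCatSheaf) (homOfLE (inf_le_right.trans inf_le_left)) κ₁
  let w : SheafOfModules.free I ≅ F.over W :=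
    Motives.SheafOfModules.restrictTrivialisation (R := X.ringCatSheaf) (homOfLE (inf_le_right.trans inf_le_right)) w₂
  have hxW : x ∈ W := ⟨hx₀, hx₁, hx₂⟩
  let r : F.over W ⟶ K.over W := restrictHom (homOfLE h0) r₀
  have hr : (SheafOfModules.overFunctor _ W).map τ ≫ r = 𝟙 _ := by
    refine hom_ext_of_appLE fun V k s => ?_
    have h := congrArg (fun χ => appLE χ (k ≫ homOfLE h0) s) hr₀
    simpa only [appLE_comp, appLE_over_map, appLE_id, r, appLE_restrictHom] using h
  refine ⟨W, hxW, Fin 1 × I, inferInstance, homFrame κ w, ?_⟩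
  -- the coordinates `c_i` of `τ(b)` and the relation `1 = ∑ c_i λ(r(w_i))`
  set b : Γ(K, W) := basisSection κ 0 with hb
  let c : I → Γ(X, W) := fun i => coord w (𝟙 W) (τ.app W b) i
  let d : I → Γ(X, W) := fun i => coord κ (𝟙 W) (appLE r (𝟙 W) (basisSection w i)) 0
  have hsum : (1 : Γ(X, W)) = ∑ i, c i * d i := by
    have hτb : τ.app W b = ∑ i, c i • basisSection w i := by
      conv_lhs => rw [eq_sum_coord_smul w (𝟙 W) (τ.app W b)]
      simp only [presheaf_map_id]
      rfl
    have hrb : appLE r (𝟙 W) (τ.app W b) = b := by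
      have h := congrArg (fun χ => appLE χ (𝟙 W) b) hr
      simpa only [appLE_comp, appLE_over_map, appLE_id] using h
    have h1 : coord κ (𝟙 W) b 0 = 1 := by rw [hb, coord_basisSection, if_pos rfl]
    rw [← h1, ← hrb, hτb, appLE_sum_right, coord_sum]
    refine Finset.sum_congr rfl fun i _ => ?_
    rw [appLE_smul_right, coord_smul]
  -- if no `c_i` were invertible at `x`, `1` would lie in the maximal ideal of `𝒪_{X,x}`
  by_contra hne
  have hmem : ∀ i, X.presheaf.germ W x hxW (c i) ∈ IsLocalRing.maximalIdeal (X.presheaf.stalk x) := fun i => by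
    rw [← not_mem_basicOpen_iff_germ_mem_maximalIdeal]
    have h := not_exists.mp hne (0, i)
    rwa [coord_homFrame_homSection] at h
  have h1 : X.presheaf.germ W x hxW 1 ∈ IsLocalRing.maximalIdeal (X.presheaf.stalk x) := by
    rw [hsum, germ_sum_mul]
    exact Ideal.sum_mem _ fun i _ => Ideal.mul_mem_right _ _ (hmem i)
  rw [map_one] at h1
  exact (IsLocalRing.maximalIdeal.isMaximal _).ne_top (Ideal.eq_top_of_isUnit_mem _ h1 isUnit_one)

end Split

end Summit.ResolutionOfSingularities.ResolutionOfSingularities.Cruxes.EquisingularLiftNat.P1VB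

end
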